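import Literature.Analysis.FluidPDE.NSBoundedHigherRegularityQuant
import Literature.Analysis.FluidPDE.NSBootstrapHigherHolder
import Literature.Analysis.FluidPDE.SpaceTimeRescaling
import HarnessLib

/-!
# Quantitative higher interior regularity of bounded solutions — the proof

Analysis/FluidPDE proofs file (theorems only). Discharges the named fact
`NSBoundedHigherRegularityBounds` (`NSBoundedHigherRegularityQuant.lean`; Seregin–Šverák 2009,
§2 p. 8; Lemarié-Rieusset 2016, Thm. 13.1; Serrin 1962): the normalised statement
`NSBootstrap.exists_smooth_holder_rep_norm` (the Serrin bootstrap of the `NSBootstrap*` files: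
represented derivatives of all orders bounded by constants fixed before the solution, smooth
slices by mollification, the joint-Hölder representative, Landau interpolation) is transported
from `Q(0, R)` to `Q(z, R)` by the translation `(s, y) ↦ (z.1 + s, z.2 + y)`
(`IsDistributionalNSSolutionOn.stRescale` with `α = β = γ = 1`).

## References

* G. Seregin, V. Šverák, Comm. PDE 34 (2009) = arXiv:0804.1803, §2 p. 8. [`SereginSverak2009`]
* P. G. Lemarié-Rieusset, *The Navier–Stokes Problem in the 21st Century* (2016), Thm. 13.1.
  [`LemarieRieusset2016`]
* J. Serrin, Arch. Rational Mech. Anal. 9 (1962) 187–195. [folklore]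
-/

noncomputable section

open MeasureTheory Set Function Filter Topology TopologicalSpace Metric
open scoped NNReal ENNReal

namespace Literature.Analysis.FluidPDE

open NSBootstrap

/-- The translated cylinder is the normalised one. [folklore] -/
theorem stAffine_one_preimage_parabolicCylinder (R : ℝ) (z : ℝ × EuclideanSpace ℝ (Fin 3)) :
    stAffine 1 1 z.1 z.2 ⁻¹' parabolicCylinder R z = parabolicCylinder R (0 : ℝ × EuclideanSpace ℝ (Fin 3)) := by
  rw [parabolicCylinder, stAffine_preimage_cylinder one_pos one_pos, parabolicCylinder]
  congr 1
  · congr 1 <;> simp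
  · simp

/-- The translated cylinder, as an open set. [folklore] -/
theorem stPreimage_one_parabolicCylinderOpens (R : ℝ) (z : ℝ × EuclideanSpace ℝ (Fin 3)) :
    stPreimage 1 1 z.1 z.2 (parabolicCylinderOpens R z) = parabolicCylinderOpens R (0 : ℝ × EuclideanSpace ℝ (Fin 3)) := by
  ext1
  rw [coe_stPreimage, coe_parabolicCylinderOpens, coe_parabolicCylinderOpens, stAffine_one_preimage_parabolicCylinder]

/-- Translation maps `Q(z, r)` into `Q(0, r)`. [folklore] -/
theorem sub_mem_parabolicCylinder_zero {r : ℝ} {z w : ℝ × EuclideanSpace ℝ (Fin 3)} (hw : w ∈ parabolicCylinder r z) :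
    w - z ∈ parabolicCylinder r (0 : ℝ × EuclideanSpace ℝ (Fin 3)) := by
  rw [mem_parabolicCylinder] at hw ⊢
  obtain ⟨⟨h1, h2⟩, h3⟩ := hw
  refine ⟨⟨by simp only [Prod.fst_sub, Prod.fst_zero]; linarith, by simp only [Prod.fst_sub, Prod.fst_zero]; linarith⟩, ?_⟩
  simpa [dist_eq_norm] using h3

/-- **Quantitative higher interior regularity of bounded distributional Navier–Stokes
solutions** (Seregin–Šverák 2009, §2 p. 8; Lemarié-Rieusset 2016, Thm. 13.1; Serrin 1962):
the named fact `NSBoundedHigherRegularityBounds` holds. [cite: SereginSverak2009, §2 p. 8] -/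
theorem NSBoundedHigherRegularityBounds_holds : NSBoundedHigherRegularityBounds := by
  intro R M P
  obtain ⟨K, C, α, hα, hnorm⟩ := exists_smooth_holder_rep_norm R M P
  refine ⟨K, C, α, hα, ?_⟩
  intro u p z hsol hbd hP
  -- the translated solution on `Q(0, R)`
  set ut : ℝ → EuclideanSpace ℝ (Fin 3) → EuclideanSpace ℝ (Fin 3) := (1 : ℝ) • stPull 1 1 z.1 z.2 u with hut
  set pt : ℝ → EuclideanSpace ℝ (Fin 3) → ℝ := ((1 : ℝ) ^ 2) • stPull 1 1 z.1 z.2 p with hpt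
  have hsol' : IsDistributionalNSSolutionOn (parabolicCylinderOpens R (0 : ℝ × EuclideanSpace ℝ (Fin 3))) 1 0 ut pt := by
    have h := hsol.stRescale one_pos one_pos (show (1 : ℝ) = 1 * 1 by norm_num) z.1 z.2
    rw [stPreimage_one_parabolicCylinderOpens] at h
    have e1 : (1 : ℝ) * 1 / 1 = 1 := by norm_num
    have e2 : (((1 : ℝ) ^ 2 * 1) • stPull 1 1 z.1 z.2 (0 : ℝ → EuclideanSpace ℝ (Fin 3) → EuclideanSpace ℝ (Fin 3))) = 0 := by
      funext s y; simp [stPull]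
    rw [e1, e2] at h
    exact h
  have hbd' : ∀ᵐ w ∂(volume.restrict (parabolicCylinder R (0 : ℝ × EuclideanSpace ℝ (Fin 3)))), ‖ut w.1 w.2‖ ≤ M := by
    have h := ae_restrict_preimage_stAffine one_pos one_pos z.1 z.2 (P := fun w => ‖u w.1 w.2‖ ≤ M) hbd
    rw [stAffine_one_preimage_parabolicCylinder] at h
    filter_upwards [h] with w hw
    simpa [hut, stPull, stAffine] using hw
  have hP' : ∫⁻ w in parabolicCylinder R (0 : ℝ × EuclideanSpace ℝ (Fin 3)), ‖pt w.1 w.2‖ₑ ^ (3 / 2 : ℝ) ≤ P := by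
    have h := setLIntegral_enorm_rpow_stRescale one_pos one_pos z.1 z.2 ((1 : ℝ) ^ 2) p (parabolicCylinder R z)
      (r := 3 / 2) (by norm_num)
    rw [stAffine_one_preimage_parabolicCylinder] at h
    rw [hpt, h]
    simpa using hP
  obtain ⟨Vt, hVae, hVs, hVn⟩ := hnorm ut pt hsol' hbd' hP'
  -- translate back
  set V : ℝ → EuclideanSpace ℝ (Fin 3) → EuclideanSpace ℝ (Fin 3) := fun t x => Vt (t - z.1) (x - z.2) with hV
  have hVslice : ∀ t, V t = fun x => Vt (t - z.1) (x - z.2) := fun t => rfl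
  have hD : ∀ (n : ℕ) (w : ℝ × EuclideanSpace ℝ (Fin 3)), iteratedFDeriv ℝ n (V w.1) w.2 =
      iteratedFDeriv ℝ n (Vt (w - z).1) (w - z).2 := by
    intro n w
    rw [Prod.fst_sub, Prod.snd_sub, hVslice w.1, iteratedFDeriv_comp_sub' n z.2]
  refine ⟨V, ?_, ?_, fun n r hr => ?_⟩
  · -- a.e. equality
    refine ae_restrict_of_ae_restrict_preimage_stAffine one_pos one_pos z.1 z.2
      (P := fun w => uncurry u w = uncurry V w) ?_
    rw [stAffine_one_preimage_parabolicCylinder]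
    filter_upwards [hVae] with w hw
    have hw' : ut w.1 w.2 = Vt w.1 w.2 := hw
    simp only [hut, one_smul, stPull_apply] at hw'
    show u (stAffine 1 1 z.1 z.2 w).1 (stAffine 1 1 z.1 z.2 w).2 =
      Vt ((stAffine 1 1 z.1 z.2 w).1 - z.1) ((stAffine 1 1 z.1 z.2 w).2 - z.2)
    rw [stAffine_fst, stAffine_snd, one_smul, hw']
    congr 1
    · ring
    · simp
  · -- smooth slices
    intro w hw
    have hw' := sub_mem_parabolicCylinder_zero hw
    have h1 := hVs _ hw'
    rw [Prod.fst_sub, Prod.snd_sub] at h1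
    rw [hVslice w.1]
    have h2 : ContDiffAt ℝ (⊤ : ℕ∞) (fun x : EuclideanSpace ℝ (Fin 3) => x - z.2) w.2 :=
      (contDiff_id.sub contDiff_const).contDiffAt
    exact h1.comp w.2 h2
  · obtain ⟨hH, hB⟩ := hVn n r hr
    refine ⟨?_, fun w hw => ?_⟩
    · intro w hw w' hw'
      have h := hH _ (sub_mem_parabolicCylinder_zero hw) _ (sub_mem_parabolicCylinder_zero hw')
      rw [edist_sub_right] at h
      show edist (iteratedFDeriv ℝ n (V w.1) w.2) (iteratedFDeriv ℝ n (V w'.1) w'.2) ≤ _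
      rw [hD n w, hD n w']
      exact h
    · rw [hD n w]
      exact hB _ (sub_mem_parabolicCylinder_zero hw)

end Literature.Analysis.FluidPDE

end
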